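import Literature.NumberTheory.EllipticCurves.PadicLogLatticeIndexProofs
import Literature.NumberTheory.EllipticCurves.VariableChangePoints
import Literature.NumberTheory.EllipticCurves.Kato2004.LocPKummerLog
import HarnessLib

/-!
# `p`-adic approximation of local points by a rational point of infinite order:
# `M · E(ℚ_p) ⊆ ℤ·Q + p^k E(ℚ_p)` for every `k`, with ONE integer `M ≠ 0` (the log lattice of `E(ℚ_p)`)
# (route `KatoDescentPotSupersingular` / `…Tame…`, crux M = stmt-BirchSwinnertonDyer-19196; route-free helper)

Seat `bsd-potss-rkm` g25 (prover; cell `bsd-potss`), item stmt-BirchSwinnertonDyer-19196 `ReducibleKatoMember`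
(`--supports … --as helper`; closes nothing).  HONEST FRAMING: BSD is not proved by any of this; nothing is booked; theorems only
(no definition, no named fact).

## Why

Crux M's held CORE package (`Kato2004.exists_memberHullZetaCoreInputs`, clause (b′) `ZetaLineOrthIndexAt`) forces the bottom zeta
class to have a local index at `p`; the companion file `…ZetaLineRankZero` turns that into Kato's Thm. 14.5 rank statement
«`W(ℚ)` is finite» WITHOUT Gross–Zagier–Kolyvagin.  The local input is this file: a rational point `Q` of infinite order fills,
up to ONE bounded integer `M`, every level `E(ℚ_p)/p^k` — so a functional on `E(ℚ_p)/p^k` vanishing on the image of `ℤ·Q` is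
killed by `M`, uniformly in `k`.

## What

* `exists_mul_smul_eq_zsmul_add_pow_smul_of_isIntegral` — `W` a `ℤ_p`-integral elliptic equation over `ℚ_p`, `Q ∈ E(ℚ_p)` of
  infinite order: **`∃ M ≠ 0, ∀ k x, ∃ n y, M•x = n•Q + p^k•y`**.  PROOF (the log lattice, kmc g14 `PadicLogLatticeIndexProofs`):
  `Φ(P) = L([E:E⁽²⁾]•P)` is additive with kernel `E(ℚ_p)_tors` (finite, order `T`) and range the ball `ℤ_p·c`; `Φ(Q) = u p^a c`
  (`u ∈ ℤ_pˣ`); for `Φ(x) = s c` approximate `s u⁻¹` by an integer `n₀` modulo `p^k` (`PadicInt.appr`): `p^a x − n₀ Q − p^k y'`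
  lies in `ker Φ`, and `T` kills it; `M = T p^a`.
* `exists_mul_smul_eq_zsmul_add_pow_smul_padic` — the same for ANY elliptic `W` over `ℚ_p` (scale to an integral equation,
  Mathlib `exists_isIntegral`, tree `VariableChange.pointEquiv`).
* `exists_mul_smul_eq_zsmul_add_pow_smul_adicCompletion` — the same for the `ℚ_v`-points of `W/ℚ` at `v = primePlace p`
  (`ℚ_v ≅ ℚ_p`, Mathlib `Padic.adicCompletionEquiv`), the currency of the tree's local Kummer map.

References: J. H. Silverman, *AEC* 2nd ed. (2009), IV.6.4, VII.3.1, VII.6.3 [SilvermanAEC2009]; C.-H. Kim, K. Nakamura, J. Number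
Theory 210 (2020), Cor. 2.4 [KimNakamura2020].
-/

-- the summit and its single problem are both named `BirchSwinnertonDyer` (registry layout D-0017)
set_option linter.dupNamespace false
set_option autoImplicit false

noncomputable section

open scoped Classical NumberField
open Function IsDedekindDomain WeierstrassCurve
open Literature.NumberTheory.EllipticCurves Literature.NumberTheory.EllipticCurves.Kato2004

namespace Summit.BirchSwinnertonDyer.BirchSwinnertonDyer.Theorems.PadicPointsApproximation

/-! ## §1 Transport of the statement along an additive isomorphism / an injective map -/

section Transport

variable {p : ℕ}

/-- The approximation statement is invariant under isomorphism of groups. [cite: SilvermanAEC2009, VII.6.3] -/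
theorem approx_of_addEquiv {A B : Type*} [AddCommGroup A] [AddCommGroup B] (e : A ≃+ B) {Q : A}
    (h : ∃ M : ℕ, M ≠ 0 ∧ ∀ (k : ℕ) (x : B), ∃ (n : ℤ) (y : B), (M : ℤ) • x = n • e Q + ((p ^ k : ℕ) : ℤ) • y) :
    ∃ M : ℕ, M ≠ 0 ∧ ∀ (k : ℕ) (x : A), ∃ (n : ℤ) (y : A), (M : ℤ) • x = n • Q + ((p ^ k : ℕ) : ℤ) • y := by
  obtain ⟨M, hM, h⟩ := h
  refine ⟨M, hM, fun k x => ?_⟩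
  obtain ⟨n, y, hy⟩ := h k (e x)
  refine ⟨n, e.symm y, e.injective ?_⟩
  rw [map_zsmul, map_add, map_zsmul, map_zsmul, e.apply_symm_apply, hy]

/-- Infinite order is invariant under an injective additive map. [cite: SilvermanAEC2009, VII.6.3] -/
theorem not_isOfFinAddOrder_map {A B : Type*} [AddCommGroup A] [AddCommGroup B] {F : Type*} [FunLike F A B]
    [AddMonoidHomClass F A B] (f : F) (hf : Injective f) {Q : A} (hQ : ¬ IsOfFinAddOrder Q) : ¬ IsOfFinAddOrder (f Q) := by
  intro h
  obtain ⟨n, hn, hnQ⟩ := h.exists_nsmul_eq_zero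
  exact hQ (isOfFinAddOrder_iff_nsmul_eq_zero.mpr ⟨n, hn, hf (by rw [map_nsmul, hnQ, map_zero])⟩)

end Transport

/-! ## §2 The integral equation over `ℚ_p`: the log lattice -/

section Integral

variable {p : ℕ} [hp : Fact p.Prime] (W : WeierstrassCurve ℚ_[p]) [hW : W.IsIntegral ℤ_[p]] [W.IsElliptic]

/-- In a finite subgroup, the order of the subgroup kills every element. [cite: SilvermanAEC2009, VII.3.1] -/
theorem natCard_nsmul_eq_zero_of_mem {G : Type*} [AddCommGroup G] (H : AddSubgroup G) [Finite H] {x : G} (hx : x ∈ H) :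
    Nat.card H • x = 0 := by
  have h : Nat.card H • (⟨x, hx⟩ : H) = 0 := addOrderOf_dvd_iff_nsmul_eq_zero.mp (addOrderOf_dvd_natCard _)
  exact congrArg Subtype.val h

/-- **`p`-adic approximation by a point of infinite order, integral equation**: for a `ℤ_p`-integral elliptic equation `W`
over `ℚ_p` and `Q ∈ E(ℚ_p)` of infinite order there is `M ≠ 0` with `M • x ∈ ℤ•Q + p^k E(ℚ_p)` for EVERY `k` and every
`x ∈ E(ℚ_p)` (the scaled logarithm `Φ` has finite kernel `E(ℚ_p)_tors` and cyclic image `ℤ_p·c`).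
[cite: SilvermanAEC2009, IV.6.4 and VII.6.3] [cite: KimNakamura2020, Cor. 2.4] -/
theorem exists_mul_smul_eq_zsmul_add_pow_smul_of_isIntegral (Q : W.toAffine.Point) (hQ : ¬ IsOfFinAddOrder Q) :
    ∃ M : ℕ, M ≠ 0 ∧ ∀ (k : ℕ) (x : W.toAffine.Point), ∃ (n : ℤ) (y : W.toAffine.Point),
      (M : ℤ) • x = n • Q + ((p ^ k : ℕ) : ℤ) • y := by
  have hpp : p.Prime := hp.out
  obtain ⟨Φ, hΦ⟩ := W.exists_addMonoidHom_padicLimitLog_index_nsmul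
  have hker := W.ker_eq_torsion hΦ
  have hrange := (W.range_eq_span_and_relIndex_eq hΦ).1
  set T := Nat.card (AddCommGroup.torsion W.toAffine.Point) with hTdef
  have hT0 : T ≠ 0 := W.natCard_torsion_padicPoint_ne_zero
  haveI : Finite (AddCommGroup.torsion W.toAffine.Point) := Nat.finite_of_card_ne_zero hT0
  set c : ℚ_[p] := (T : ℚ_[p]) * (p : ℚ_[p]) ^ 2 with hcdef
  -- every value of `Φ` is `s • c`, `s ∈ ℤ_p`
  have hval : ∀ x : W.toAffine.Point, ∃ s : ℤ_[p], (s : ℚ_[p]) * c = Φ x := fun x => by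
    have hx : Φ x ∈ Φ.range := ⟨x, rfl⟩
    rw [hrange, Submodule.mem_toAddSubgroup, Submodule.mem_span_singleton] at hx
    obtain ⟨s, hs⟩ := hx
    exact ⟨s, by rw [← hs, Algebra.smul_def]; rfl⟩
  have hsurj : ∀ s : ℤ_[p], ∃ y : W.toAffine.Point, Φ y = (s : ℚ_[p]) * c := fun s => by
    have hs : (s : ℚ_[p]) * c ∈ Φ.range := by
      rw [hrange, Submodule.mem_toAddSubgroup, Submodule.mem_span_singleton]
      exact ⟨s, by rw [Algebra.smul_def]; rfl⟩
    obtain ⟨y, hy⟩ := hs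
    exact ⟨y, hy⟩
  -- `Φ Q = u p^a c`, `u` a unit
  obtain ⟨q, hq⟩ := hval Q
  have hq0 : q ≠ 0 := by
    intro h
    apply hQ
    rw [← AddCommGroup.mem_torsion, ← hker, AddMonoidHom.mem_ker, ← hq, h, PadicInt.coe_zero, zero_mul]
  set a : ℕ := q.valuation with hadef
  set u : ℤ_[p]ˣ := PadicInt.unitCoeff hq0 with hudef
  have hqu : q = (u : ℤ_[p]) * (p : ℤ_[p]) ^ a := PadicInt.unitCoeff_spec hq0
  refine ⟨T * p ^ a, mul_ne_zero hT0 (pow_ne_zero _ hpp.ne_zero), fun k x => ?_⟩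
  obtain ⟨s, hs⟩ := hval x
  -- approximate `t = s u⁻¹` by a natural number `n₀` modulo `p^k`
  set t : ℤ_[p] := s * ((u⁻¹ : ℤ_[p]ˣ) : ℤ_[p]) with htdef
  have happr := PadicInt.appr_spec k t
  rw [Ideal.mem_span_singleton] at happr
  obtain ⟨r, hr⟩ := happr
  set n₀ : ℕ := t.appr k with hn₀def
  obtain ⟨y', hy'⟩ := hsurj ((p : ℤ_[p]) ^ a * (u : ℤ_[p]) * r)
  -- the element `p^a • x - n₀ • Q - p^k • y'` is killed by `Φ`
  have huinv : ((u : ℤ_[p]) : ℚ_[p]) * (((u⁻¹ : ℤ_[p]ˣ) : ℤ_[p]) : ℚ_[p]) = 1 := by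
    rw [← PadicInt.coe_mul, Units.mul_inv, PadicInt.coe_one]
  have ht : ((t : ℤ_[p]) : ℚ_[p]) = (s : ℚ_[p]) * (((u⁻¹ : ℤ_[p]ˣ) : ℤ_[p]) : ℚ_[p]) := by
    rw [htdef, PadicInt.coe_mul]
  have hr' : ((t : ℤ_[p]) : ℚ_[p]) - (n₀ : ℚ_[p]) = ((p : ℚ_[p]) ^ k) * (r : ℚ_[p]) := by
    have := congrArg ((↑) : ℤ_[p] → ℚ_[p]) hr
    push_cast at this
    exact this
  have hz : Φ (((p ^ a : ℕ) : ℤ) • x - (n₀ : ℤ) • Q - ((p ^ k : ℕ) : ℤ) • y') = 0 := by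
    rw [map_sub, map_sub, map_zsmul, map_zsmul, map_zsmul, ← hs, ← hq, hy', hqu]
    push_cast
    rw [zsmul_eq_mul, zsmul_eq_mul, zsmul_eq_mul]
    push_cast
    linear_combination ((p : ℚ_[p]) ^ a * c * ((u : ℤ_[p]) : ℚ_[p])) * hr' +
      (-((p : ℚ_[p]) ^ a * c * ((u : ℤ_[p]) : ℚ_[p]))) * ht + (-((p : ℚ_[p]) ^ a * c * (s : ℚ_[p]))) * huinv
  have hzt : ((p ^ a : ℕ) : ℤ) • x - (n₀ : ℤ) • Q - ((p ^ k : ℕ) : ℤ) • y' ∈ AddCommGroup.torsion W.toAffine.Point := by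
    rw [← hker]; exact hz
  have hkill := natCard_nsmul_eq_zero_of_mem (AddCommGroup.torsion W.toAffine.Point) hzt
  rw [← hTdef] at hkill
  have hkill' : (T : ℤ) • ((((p ^ a : ℕ) : ℤ) • x - (n₀ : ℤ) • Q) - ((p ^ k : ℕ) : ℤ) • y') = 0 := by
    rw [natCast_zsmul]; exact hkill
  rw [zsmul_sub, zsmul_sub, sub_sub, sub_eq_zero] at hkill'
  refine ⟨(T : ℤ) * n₀, (T : ℤ) • y', ?_⟩
  rw [Nat.cast_mul, mul_zsmul x, mul_zsmul Q, ← mul_zsmul y', mul_comm (((p ^ k : ℕ) : ℤ)) (T : ℤ), mul_zsmul y']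
  exact hkill'

end Integral

/-! ## §3 Any elliptic equation over `ℚ_p`; the `ℚ_v`-points of a curve over `ℚ` -/

section Padic

variable {p : ℕ} [hp : Fact p.Prime]

/-- **`p`-adic approximation by a point of infinite order** for ANY elliptic curve over `ℚ_p` (scale to a `ℤ_p`-integral
equation by Mathlib's `exists_isIntegral`; the point groups are identified by `VariableChange.pointEquiv`).
[cite: SilvermanAEC2009, VII.6.3] -/
theorem exists_mul_smul_eq_zsmul_add_pow_smul_padic (W : WeierstrassCurve ℚ_[p]) [W.IsElliptic] (Q : W.toAffine.Point)
    (hQ : ¬ IsOfFinAddOrder Q) :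
    ∃ M : ℕ, M ≠ 0 ∧ ∀ (k : ℕ) (x : W.toAffine.Point), ∃ (n : ℤ) (y : W.toAffine.Point),
      (M : ℤ) • x = n • Q + ((p ^ k : ℕ) : ℤ) • y := by
  obtain ⟨C, hC⟩ := W.exists_isIntegral ℤ_[p]
  haveI := hC
  exact approx_of_addEquiv (VariableChange.pointEquiv W C)
    (exists_mul_smul_eq_zsmul_add_pow_smul_of_isIntegral (C • W) _
      (not_isOfFinAddOrder_map (VariableChange.pointEquiv W C) (VariableChange.pointEquiv W C).injective hQ))

variable (W : WeierstrassCurve ℚ) [W.IsElliptic] (p)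

omit [W.IsElliptic] in
/-- Base change of points along the `ℚ`-algebra identity is the identity. [cite: SilvermanAEC2009, VII.6.3] -/
private theorem map_algHom_id_aux {F : Type*} [Field F] [Algebra ℚ F] (Q : (W.baseChange F).toAffine.Point) :
    Affine.Point.map (AlgHom.id ℚ F) Q = Q := by
  cases Q <;> rfl

omit [W.IsElliptic] in
/-- **`E(ℚ_v) ≃+ E(ℚ_p)`** for `v = primePlace p`, along Mathlib's `Padic.adicCompletionEquiv`. [cite: SilvermanAEC2009, VII.6.3] -/
theorem nonempty_pointAddEquiv_primePlace_padic :
    Nonempty ((W.baseChange ((primePlace p).adicCompletion ℚ)).toAffine.Point ≃+ (W.baseChange ℚ_[p]).toAffine.Point) := by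
  let e : ℚ_[p] ≃ₐ[ℚ] (primePlace p).adicCompletion ℚ := (Padic.adicCompletionEquiv (R := 𝓞 ℚ) ⟨p, Fact.out⟩).toAlgEquiv
  refine ⟨AddEquiv.ofBijective
    (Affine.Point.map (W' := W) (e.symm : (primePlace p).adicCompletion ℚ →ₐ[ℚ] ℚ_[p]))
    ⟨Affine.Point.map_injective (W' := W) _, fun R ↦
      ⟨Affine.Point.map (W' := W) (e : ℚ_[p] →ₐ[ℚ] (primePlace p).adicCompletion ℚ) R, ?_⟩⟩⟩
  rw [Affine.Point.map_map, AlgEquiv.symm_comp, map_algHom_id_aux]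

/-- **`p`-adic approximation by a point of infinite order, `ℚ_v`-currency**: for an elliptic curve `W/ℚ`, `v = primePlace p`,
and `Q ∈ E(ℚ_v)` of infinite order there is `M ≠ 0` with **`M • x ∈ ℤ•Q + p^k E(ℚ_v)`** for every `k` and every `x ∈ E(ℚ_v)`.
[cite: SilvermanAEC2009, IV.6.4 and VII.6.3] [cite: KimNakamura2020, Cor. 2.4] -/
theorem exists_mul_smul_eq_zsmul_add_pow_smul_adicCompletion
    (Q : (W.baseChange ((primePlace p).adicCompletion ℚ)).toAffine.Point) (hQ : ¬ IsOfFinAddOrder Q) :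
    ∃ M : ℕ, M ≠ 0 ∧ ∀ (k : ℕ) (x : (W.baseChange ((primePlace p).adicCompletion ℚ)).toAffine.Point),
      ∃ (n : ℤ) (y : (W.baseChange ((primePlace p).adicCompletion ℚ)).toAffine.Point),
        (M : ℤ) • x = n • Q + ((p ^ k : ℕ) : ℤ) • y := by
  obtain ⟨e⟩ := nonempty_pointAddEquiv_primePlace_padic p W
  haveI : (W.baseChange ℚ_[p]).IsElliptic := by rw [baseChange]; infer_instance
  exact approx_of_addEquiv e
    (exists_mul_smul_eq_zsmul_add_pow_smul_padic (W.baseChange ℚ_[p]) (e Q) (not_isOfFinAddOrder_map e e.injective hQ))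

end Padic

end Summit.BirchSwinnertonDyer.BirchSwinnertonDyer.Theorems.PadicPointsApproximation

end
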